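import Literature.MathematicalPhysics.QuantumFieldTheory.Balaban1983to89.Node00.Record5C
import Literature.MathematicalPhysics.QuantumFieldTheory.Balaban1983to89.Node00.SmallFieldChiOfRecord
import Literature.MathematicalPhysics.QuantumFieldTheory.Balaban1983to89.Node00.ROperationOfRecord

/-!
# NODE 00 (YM-PLAN Track A) — STAGE 7 OF THE RECORD CHAIN: `IsRecordOfRecord₇C` — the Stage-5 record (C-binding) WHOSE residual small-field
# characteristic functions `χ_k` ((2.17) [III]), normalisation `E` ((1.15) ∕ Thm 1 [III]), second-form small-field domain and large-field operation
# `R` (the §0 form (0.3) [IV] on the represented tower) ARE def-R's objects of record; refinement `IsRecordOfRecord₇C → IsRecordOfRecord₅C`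

NODE 00 STAGE-7 MODULE (seat `pub-ymgap-node00-def`; assembles the dedicated definer `pub-ymgap-node00-def-R`'s `Node00/SmallFieldChiOfRecord.lean` +
`Node00/ROperationOfRecord.lean` per DEFINER-SPEC-g28.md §1; APPEND-ONLY growth: a NEW importing module).  The RESIDUAL after this stage is SMALLER:
`R ∕ preservesIntegral_R ∕ integrable_R ∕ χ ∕ dom ∕ E` are FUNCTIONS of the numeric dictionary `Stage7Numerics`, of the NEW residual `rep : RepOfRecord`
(the (0.2) [IV] representation-extraction — pinned from [IV] §1 at stage ₇b) and of the per-run fluctuation inputs `Efl`, `logz` (owned by stage ₈,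
def-B) — and of the residual β-functions through the forward-generated couplings `genSeq βfun g₀`.  `R` here is the §0 FORM (0.3) of [Balaban1989LargeFieldI]
(`ROp03OfRecord`, total, identity off-representation; (0.4) and integrability are THEOREMS of def-R for every `rep`); the §1 procedure ∕ (1.72) [B16] is
`ROfRecord` (₇b, reserved name).
HONEST FRAMING: definitions + kernel bookkeeping; no estimate, no satisfiability; the representation `rep`, the β-functions, the actions and the [B8]–[B16]
carriers are still free DATA (the ∃-cruxes stay junk-inhabited until ₈ — director-ym LINE №17; n13-b's regression: after this stage the χ and E faces of
the flat machine must fail, the R face survives through `rep`); nothing of Bałaban's asserted; one finite T⁴ — NOT ℝ⁴ ∕ OS ∕ mass gap ∕ Clay.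
-/

noncomputable section

open MeasureTheory

namespace Literature.MathematicalPhysics.QuantumFieldTheory.Balaban1983to89.Node00

open T4Continuum AveragingRT T4FiniteEpsInhabited FlowStep FlowStepRuns DagBinding T4DatumAssembly

/-! ## §1. Stage-7 parameters -/

/-- **Stage-7 family parameters**: the Stage-5 parameters, def-R's numeric dictionary `Stage7Numerics` (cube sizes `M₁ M₂`, (2.5) exponent `r`, (2.4)
`p₀ A₀`, `log σ₀`, regularity `εreg`, second-form radius `ε₀`), the NEW residual `rep` (the (0.2) representation extraction of [Balaban1989LargeFieldI] —
pinned at stage ₇b), and the per-run fluctuation inputs `Efl`, `logz` of (1.15) [III] (stage ₈'s objects). [cite: Balaban1988Convergent, (2.4)–(2.5) p.255 and (1.15) p.249; Balaban1989LargeFieldI, (0.2) p.176 (parameter dictionary)] -/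
structure Stage7Params (Fam : T4Family) (N : ℕ) [NeZero N] extends Stage5Params Fam N where
  /-- def-R's numeric dictionary -/
  ν : Stage7Numerics
  /-- RESIDUAL: the (0.2) representation extraction (regions, `Z ↦ Z″`, fibre bonds, pieces) of every density of the tower -/
  rep : RepOfRecord Fam N
  /-- RESIDUAL (stage ₈): the fluctuation constants of (1.15), per run and scale -/
  Efl : B12.RunParams → ℕ → ℝ
  /-- RESIDUAL (stage ₈): `log z_j` of (1.15), per run and scale -/
  logz : B12.RunParams → ℕ → ℝ

variable (F : T4Family) (N : ℕ) [NeZero N]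

/-- Admissibility at Stage 7 = Stage-5 admissibility ∧ the numeric windows of def-R's dictionary under which its total definitions are print's objects
and not their junk branches (PLUG-RECIPE-7: `0 < ε₀` — non-empty second-form domain; `0 < εreg` — non-empty regularity class of (2.12); `0 < A₀` — positive
small-field radius (2.4); `1 ≤ M₁`, `1 ≤ M₂` — genuine cube partitions (2.13)∕(2.17)).  NO clause on a residual object; def-R's `TowerProvisos rep` (positivity of
the (0.3) denominators) stays DISPLAYED in its module until `rep` is pinned (chair R434 (c1)). [cite: Balaban1988Convergent, (2.4) p.255, (2.13)–(2.17) pp.256–257; Balaban1987RG1, p.259 (hypothesis dictionary)] -/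
def Stage7Params.Admissible (θ : Stage7Params F N) : Prop :=
  θ.toStage5Params.Admissible ∧ 0 < θ.ν.ε₀ ∧ 0 < θ.ν.εreg ∧ 0 < θ.ν.A₀ ∧ 1 ≤ θ.ν.M₁ ∧ 1 ≤ θ.ν.M₂

/-- **The Stage-7 residual**: the Stage-5 residual with `χ`, `dom`, `E`, `R` (+ its two obligations, now THEOREMS) OVERWRITTEN by def-R's objects of record,
read at the forward-generated couplings of the residual β-functions. [cite: Balaban1988Convergent, (2.16)–(2.17) p.257 and (1.15) p.249; Balaban1989LargeFieldI, (0.3)–(0.4) p.176 (the objects substituted)] -/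
def residualOfStage7 (θ : Stage7Params F N) : Residual₅ F N :=
  { θ.res with
    χ := fun p k => chiOfRecord F N θ.ν (genSeq θ.res.βfun p.g0) p.K k
    dom := fun p k => domAltOfRecord F N θ.ν p.K k
    E := EOfRecord F N θ.ν θ.Efl θ.logz (fun p => genSeq θ.res.βfun p.g0)
    R := ROp03OfRecord F N θ.rep
    preservesIntegral_R := preservesIntegral_ROp03OfRecord F N θ.rep
    integrable_R := integrable_ROp03OfRecord F N θ.rep }

/-- The Stage-5 view of Stage-7 parameters: same numeric dictionary and interval constant, residual overwritten. [cite: Balaban1989LargeFieldI, (0.2) p.176 (bookkeeping)] -/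
def Stage7Params.toStage5 (θ : Stage7Params F N) : Stage5Params F N :=
  { θ.toStage5Params with res := residualOfStage7 F N θ }

/-- Admissibility transports (it is the same numeric clause). [cite: Balaban1989LargeFieldII, Thm 1 p.355 (bookkeeping)] -/
theorem Stage7Params.admissible_toStage5 (θ : Stage7Params F N) (hθ : θ.Admissible) : (θ.toStage5 F N).Admissible := hθ.1

/-! ## §2. The Stage-7 record predicate (C-binding) and its refinement of Stage 5 -/

/-- **«(D, w) is the record, Stage 7»** (C-binding): a Stage-5 record of record (`IsRecordOfRecord₅C`-shape) at parameters whose residual `χ ∕ dom ∕ E ∕ R` ARE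
def-R's objects. [cite: Balaban1988Convergent, (2.16)–(2.17) p.257, (1.15) p.249, Thm 1 p.262; Balaban1989LargeFieldI, (0.2)–(0.4) p.176 (objects of record, Stage 7 dictionary)] -/
def IsRecordOfRecord₇C (D : FiniteEpsData F (SU N)) (w : WorldP) : Prop :=
  ∃ θ : Stage7Params F N, θ.Admissible ∧ D = datumOfRecord₅ F N (θ.toStage5 F N) ∧ w.C = D.C ∧ w.γ = θ.γ ∧ w.L = (θ.L : ℝ) ∧
    ∀ P : B12.RunParams, w.up P = upOfRecord₅C F N (θ.toStage5 F N) P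

variable {F N}

/-- **Refinement `IsRecordOfRecord₇C → IsRecordOfRecord₅C`** (witness: the Stage-5 view of the parameters) — everything closed over ₅C stays closed.
[cite: Balaban1989LargeFieldI, (0.2) p.176 (bookkeeping)] -/
theorem isRecordOfRecord₅C_of_isRecordOfRecord₇C {D : FiniteEpsData F (SU N)} {w : WorldP} (h : IsRecordOfRecord₇C F N D w) :
    IsRecordOfRecord₅C F N D w := by
  obtain ⟨θ, hθ, hD, hC, hγ, hL, hup⟩ := h
  exact ⟨θ.toStage5 F N, θ.admissible_toStage5 F N hθ, hD, hC, hγ, hL, hup⟩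

/-! ## §3. The objects of a Stage-7 record, unfolded (what n13-b's regression reads) -/

variable (F N)

/-- At Stage 7 the construction's characteristic function at run `p`, step `k` IS def-R's `chiOfRecord` at the run's generated couplings (`rfl`).
[cite: Balaban1988Convergent, (2.17) p.257 (bookkeeping)] -/
theorem chi_stage7 (θ : Stage7Params F N) (p : B12.RunParams) (k : ℕ) :
    ((datumOfRecord₅ F N (θ.toStage5 F N)).C p).χ k = chiOfRecord F N θ.ν (genSeq θ.res.βfun p.g0) p.K k := rfl

/-- At Stage 7 the machine's normalisation IS def-R's `EOfRecord` (`rfl`). [cite: Balaban1988Convergent, (1.15) p.249 and Thm 1 p.262 (bookkeeping)] -/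
theorem E_stage7 (θ : Stage7Params F N) (p : B12.RunParams) :
    (machineOfRecord₅ F N (θ.toStage5 F N)).E p = EOfRecord F N θ.ν θ.Efl θ.logz (fun p => genSeq θ.res.βfun p.g0) p := rfl

/-- At Stage 7 the density tower steps by def-R's `ROp03OfRecord` (one-step unfolding, `rfl`). [cite: Balaban1989LargeFieldI, (0.2)–(0.3) p.176 (bookkeeping)] -/
theorem densOfRecord₅_succ_stage7 (θ : Stage7Params F N) (p : B12.RunParams) (k : ℕ) :
    densOfRecord₅ F N (θ.toStage5 F N) p (k + 1) =
      ROp03OfRecord F N θ.rep p k (TrhoOfRecord F N p.K k (densOfRecord₅ F N (θ.toStage5 F N) p k)) := rfl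

/-- The χ of a Stage-7 record takes values in `[0, 1]` (def-R's `chiOfRecord_nonneg ∕ _le_one`) — in particular the sign convention `B16.SignConventions`
holds at the record's construction. [cite: Balaban1989LargeFieldII, (0.1) p.355 (χ_k a characteristic function; bookkeeping)] -/
theorem signConventions_stage7 (θ : Stage7Params F N) : B16.SignConventions (datumOfRecord₅ F N (θ.toStage5 F N)).C :=
  fun p k V => chiOfRecord_nonneg F N θ.ν (genSeq θ.res.βfun p.g0) p.K k V

end Literature.MathematicalPhysics.QuantumFieldTheory.Balaban1983to89.Node00

end
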